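import Summits.HodgeConjecture.HodgeConjecture.Theorems.MarkmanPartnerTransportPartnerTransportRMGenerator
import Summits.HodgeConjecture.HodgeConjecture.Theorems.MarkmanPartnerTransportPartnerTransportPicardRank
import Literature.AlgebraicGeometry.Surfaces.GeometricGenusOneAssociatedK3Surface

/-!
# Route MarkmanPartnerTransport · cruxes #4 `PicardThreeK3Squares` (stmt-HodgeConjecture-19652) ∕ #5
# `LowPicardRealMultiplication` — «√2-PARTNERED-HK», file 1∕2: the `√2`-datum of `X` DESCENDS to a K3 partner

Cell hodge-nonav, task T-P1AT-11a (planner p1 g48 ASSIGN 2026-08-29T10:18Z, memo ROUTE-P1AT §11.4; arbitration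
p3 g36 10:41Z); prover seat hodge-nonav-20241-p1 (gen 21). `--supports stmt-HodgeConjecture-19652` helper; no
Theses import (route-independent), no definition, no sorry, no new named fact; credits nothing.

For the partner data of `exists_markedHodgeIsometry_of_partner` (marked `X`, marked projective K3 `(S, η, p, x)`,
marked Hilbert square `(H, φ_H, P_H, (x,0))` with Beauville's algebraic incidence `[θ]_*`, `g` with (g1), (g2),
(g5)), exactly as «PARTNER-RM-TYPE» (`exists_generator_natDegree_of_partner`) descends an RM generator:
* `exists_sqrtTwo_descent_of_partner` — an `X`-side `√2`-datum `Θ` (rational, type-preserving, stable on the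
  `q`-transcendental classes `T_q(X) = N¹(X)^{⊥_q}`, `Θ² = 2` and multiplier `2` on `T_q(X)`) DESCENDS to
  `ψ := π ∘ e⁻¹ ∘ Θ ∘ e ∘ [θ]_*` (`e : H²(H) ⥲ H²(X)` the marked rational Hodge isometry, `π` the retraction):
  `ψ` is rational and type-preserving on `H²(S)`, `T(S)`-stable, `ψ² = 2` and multiplier `2` on `T(S)`
  (`Θ (e [θ]_* t) = e [θ]_* (ψ t)` for `t ∈ T(S)` by `exists_incidence_eq_of_bbfTransc`, and `e ∘ [θ]_*` is an
  injective isometry `(T(S), ∪) → (T_q(X), q)`); the sector clause `End_Hdg(T(X)) ⊆ ℚ + ℚΘ` descends to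
  `End_Hdg(T(S)) ⊆ ℚ + ℚψ` (conjugation `f_S ↦ e [θ]_* f_S π e⁻¹`, as in `hodgeEndomorphisms_scalar_of_partner`);
* `finrank_algebraicClasses_le_partner_succ_of_partner` — `ρ(X) ≤ ρ(S) + 1` from (g1), (g2), (g5) alone
  (`e⁻¹` embeds `N¹(X)` in `N¹(H)`; `ρ(H) ≤ ρ(S) + 1` is `finrank_algebraicClasses_le_succ_of_hilbertSquareMarking`).
File 2∕2 (`…SqrtTwoPartneredHK`) feeds `ψ` to `NikulinIsogeny.hodgeConjectureFor_square_of_{twelve,eleven}_le_of_sqrtTwo`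
and transports HC⁴(S ⊗ S) back to `X`. CONDITIONAL only on the displayed `Voisin2003_cupProduct_algebraicClasses`
(the marked Hilbert square is explicit here). Nothing here proves HC, HC_CM or HC_AV.

References: E. Markman, Compos. Math. 160 (2024) §1.1 Thm. 1.1; A. Beauville, J. Differential Geom. 18 (1983) §6
Prop. 6 and Remarque, §9 Lemme 1; Yu. G. Zarhin, J. reine angew. Math. 341 (1983) Thm. 1.5.1; D. Huybrechts,
*Lectures on K3 Surfaces* Ch. 3 Lemma 3.1; C. Voisin, *Hodge Theory I* Thm. 11.30.
-/

noncomputable section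

set_option linter.dupNamespace false

open scoped Matrix
open Module CategoryTheory MonoidalCategory
open Literature.AlgebraicTopology.SingularHomology Literature.Geometry.Kaehler
open Literature.AlgebraicGeometry Literature.AlgebraicGeometry.Motives Literature.AlgebraicGeometry.HodgeTheory
open Literature.AlgebraicGeometry.Hyperkaehler Literature.AlgebraicGeometry.Surfaces
open Summit.HodgeConjecture.HodgeConjecture.Theorems.NikulinTwinTransport
open Summit.HodgeConjecture.HodgeConjecture.Theorems.MarkmanPartnerTransport.BBFPositivity

namespace Summit.HodgeConjecture.HodgeConjecture.Theorems.MarkmanPartnerTransport.PartnerLattice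

/-- `MarkedK3Sq[X, φ, P, z]`: VERBATIM the `let MarkedK3Sq := …` binder of the route declarations of
MarkmanPartnerTransport (clauses (m1)–(m6)). Local notation only. -/
local notation3 (prettyPrint := false) "MarkedK3Sq[" X ", " φ ", " P ", " z "]" =>
  (((IsIntegralClass P ∧ ∀ Q : complexBetti X (2 * 4), IsIntegralClass Q → ∃ n : ℤ, Q = n • P) ∧
    (∀ c : complexBetti X 2, IsIntegralClass c ↔ ∃ v : K3HilbertIndex → ℤ, φ c = fun i => (v i : ℂ)) ∧
    (∀ a : complexBetti X 2, cupPowTwo a 4 = ((3 : ℂ) * (k3HilbertForm 2 (φ a) (φ a)) ^ 2) • P) ∧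
    (IsOfHodgeType 4 X 2 2 0 (LinearEquiv.symm φ z) ∧
      ∀ τ : complexBetti X 2, IsOfHodgeType 4 X 2 2 0 τ → ∃ t : ℂ, τ = t • LinearEquiv.symm φ z) ∧
    (∀ c : complexBetti X 2, IsOfHodgeType 4 X 2 1 1 c ↔
      (k3HilbertForm 2 (φ c) z = 0 ∧ k3HilbertForm 2 (φ c) (star z) = 0)) ∧
    (k3HilbertForm 2 z z = 0 ∧ 0 < (k3HilbertForm 2 (star z) z).re)))

/-- `SqrtTwoX[X, φ, Θ]`: the `X`-side `√2`-datum — `Θ` is a rational, type-preserving endomorphism of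
`H²(X(ℂ); ℂ)` mapping the `q`-transcendental classes `T_q(X) = N¹(X)^{⊥_q}` to themselves, with `Θ² = 2` and
multiplier `2` (for the Beauville–Bogomolov form `q` in the marking `φ`) on `T_q(X)`. Local notation only. -/
local notation3 (prettyPrint := false) "SqrtTwoX[" X ", " φ ", " Θ "]" =>
  ((∀ y, IsRationalClass y → IsRationalClass (Θ y)) ∧
    (∀ (i j : ℕ) y, IsOfHodgeType 4 X 2 i j y → IsOfHodgeType 4 X 2 i j (Θ y)) ∧
    (∀ y : complexBetti X 2,
      (∀ d : complexBetti X 2, d ∈ algebraicClasses X 1 → k3HilbertForm 2 (φ y) (φ d) = 0) →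
      ∀ d : complexBetti X 2, d ∈ algebraicClasses X 1 → k3HilbertForm 2 (φ (Θ y)) (φ d) = 0) ∧
    (∀ y : complexBetti X 2,
      (∀ d : complexBetti X 2, d ∈ algebraicClasses X 1 → k3HilbertForm 2 (φ y) (φ d) = 0) →
      Θ (Θ y) = (2 : ℂ) • y) ∧
    (∀ y : complexBetti X 2,
      (∀ d : complexBetti X 2, d ∈ algebraicClasses X 1 → k3HilbertForm 2 (φ y) (φ d) = 0) →
      ∀ w : complexBetti X 2,
        (∀ d : complexBetti X 2, d ∈ algebraicClasses X 1 → k3HilbertForm 2 (φ w) (φ d) = 0) →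
        k3HilbertForm 2 (φ (Θ y)) (φ (Θ w)) = (2 : ℂ) * k3HilbertForm 2 (φ y) (φ w)))

/-- `SectorX[X, φ, Θ]`: the `X`-side sector clause `End_Hdg(T(X)) ⊆ ℚ + ℚΘ` — every rational Hodge
endomorphism of `H²(X)` killing `N¹(X)` with `q`-transcendental image is `a + bΘ` (`a, b ∈ ℚ`) on `T_q(X)`.
Local notation only. -/
local notation3 (prettyPrint := false) "SectorX[" X ", " φ ", " Θ "]" =>
  (∀ f : complexBetti X 2 →ₗ[ℂ] complexBetti X 2,
    (∀ y, IsRationalClass y → IsRationalClass (f y)) →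
    (∀ (i j : ℕ) y, IsOfHodgeType 4 X 2 i j y → IsOfHodgeType 4 X 2 i j (f y)) →
    (∀ d : complexBetti X 2, d ∈ algebraicClasses X 1 → f d = 0) →
    (∀ y : complexBetti X 2, ∀ d : complexBetti X 2, d ∈ algebraicClasses X 1 →
      k3HilbertForm 2 (φ (f y)) (φ d) = 0) →
    ∃ a b : ℚ, ∀ y : complexBetti X 2,
      (∀ d : complexBetti X 2, d ∈ algebraicClasses X 1 → k3HilbertForm 2 (φ y) (φ d) = 0) →
      f y = (a : ℂ) • y + (b : ℂ) • Θ y)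

/-- `SectorS[S, ψ]`: the `S`-side sector clause `End_Hdg(T(S)) ⊆ ℚ + ℚψ`, VERBATIM the last clause of the
`√2`-sector data of `NikulinIsogeny.hodgeConjectureFor_square_of_eleven_le_of_sqrtTwo`. Local notation only. -/
local notation3 (prettyPrint := false) "SectorS[" S ", " ψ "]" =>
  (∀ (f : complexBetti S (2 * 1) →ₗ[ℂ] complexBetti S (2 * 1)),
    (∀ y, IsRationalClass y → IsRationalClass (f y)) →
    (∀ (i j : ℕ) y, IsOfHodgeType 2 S (2 * 1) i j y → IsOfHodgeType 2 S (2 * 1) i j (f y)) →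
    (∀ d ∈ algebraicClasses S 1, f d = 0) →
    (∀ y : complexBetti S (2 * 1), ∀ d ∈ algebraicClasses S 1,
      cupProduct (rfl : 2 * 1 + 2 * 1 = 2 * 2) (f y) d = 0) →
    ∃ a b : ℚ, ∀ y : complexBetti S (2 * 1),
      (∀ d ∈ algebraicClasses S 1, cupProduct (rfl : 2 * 1 + 2 * 1 = 2 * 2) y d = 0) →
      f y = (a : ℂ) • y + (b : ℂ) • ψ y)

variable {X S H : SchemeOver ℂ} {φ : complexBetti X 2 ≃ₗ[ℂ] (K3HilbertIndex → ℂ)} {P : complexBetti X (2 * 4)}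
  {z : K3HilbertIndex → ℂ} {η : complexBetti S (2 * 1) ≃ₗ[ℂ] (K3Index → ℂ)} {p : complexBetti S (2 * 2)}
  {x : K3Index → ℂ} {φH : complexBetti H 2 ≃ₗ[ℂ] (K3HilbertIndex → ℂ)} {PH : complexBetti H (2 * 4)}

/-! ### Descent of the `√2`-datum along a partner -/

/-- **The `X`-side `√2`-datum descends to the K3 partner** (module docstring). Along the partner data (marked
`X`, marked projective K3 `S`, marked Hilbert square `H` with algebraic incidence, `g` with (g1), (g2), (g5)),
`SqrtTwoX[X, φ, Θ]` yields `ψ = π ∘ e⁻¹ ∘ Θ ∘ e ∘ [θ]_*` on `H²(S)`: rational, type-preserving, `T(S)`-stable,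
`ψ² = 2` and multiplier `2` on `T(S)`; and the sector clause `End_Hdg(T(X)) ⊆ ℚ + ℚΘ` descends to
`End_Hdg(T(S)) ⊆ ℚ + ℚψ`. [cite: Markman2024, §1.1 Thm. 1.1] [cite: Beauville1983, §6 Prop. 6 and §9 Lemme 1]
[cite: Zarhin1983HodgeGroupsK3, Thm. 1.5.1] [cite: Huybrechts2016K3, Ch. 3 Lemma 3.1] -/
theorem exists_sqrtTwo_descent_of_partner
    (hcup : Voisin2003_cupProduct_algebraicClasses) {μ : OrientationFamily} (hμ : μ.HasPoincareDuality)
    (hX : IsSmoothProjective 4 X) (hM : MarkedK3Sq[X, φ, P, z]) (hS : IsK3Surface S) (hp0 : p ≠ 0)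
    (hηint : ∀ c : complexBetti S (2 * 1), IsIntegralClass c ↔ ∃ v : K3Index → ℤ, η c = fun i => (v i : ℂ))
    (hcupS : ∀ a b : complexBetti S (2 * 1),
      cupProduct (rfl : 2 * 1 + 2 * 1 = 2 * 2) a b = k3Form (η a) (η b) • p)
    (h20 : IsOfHodgeType 2 S (2 * 1) 2 0 (η.symm x))
    (h20span : ∀ τ : complexBetti S (2 * 1), IsOfHodgeType 2 S (2 * 1) 2 0 τ → ∃ t : ℂ, τ = t • η.symm x)
    (hxpos : 0 < (k3Form (star x) x).re)
    (hH : IsSmoothProjective 4 H) (hMH : MarkedK3Sq[H, φH, PH, Sum.elim x 0])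
    {θ : complexBetti (H ⊗ S) (2 * 2)} (hθ : θ ∈ algebraicClasses (H ⊗ S) 2)
    (hi : ∀ a : complexBetti S (2 * 1),
      φH (corrAction μ hH (IsK3Surface.isSmoothProjective hS) (rfl : 2 * 1 + 2 * 2 = 2 + 2 * 2) θ a) =
        Sum.elim (η a) 0)
    {g : complexBetti S (2 * 1) →ₗ[ℂ] complexBetti X 2}
    (hg1 : ∀ a, IsRationalClass a → IsRationalClass (g a))
    (hg2 : ∀ (i j : ℕ) a, IsOfHodgeType 2 S (2 * 1) i j a → IsOfHodgeType 4 X 2 i j (g a))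
    (hg5 : ∀ a b, (∀ d ∈ algebraicClasses S 1, cupProduct (rfl : 2 * 1 + 2 * 1 = 2 * 2) a d = 0) →
      (∀ d ∈ algebraicClasses S 1, cupProduct (rfl : 2 * 1 + 2 * 1 = 2 * 2) b d = 0) →
      k3HilbertForm 2 (φ (g a)) (φ (g b)) = k3Form (η a) (η b))
    {Θ : complexBetti X 2 →ₗ[ℂ] complexBetti X 2} (hΘ : SqrtTwoX[X, φ, Θ]) :
    ∃ ψ : complexBetti S (2 * 1) →ₗ[ℂ] complexBetti S (2 * 1),
      (∀ y, IsRationalClass y → IsRationalClass (ψ y)) ∧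
      (∀ (i j : ℕ) y, IsOfHodgeType 2 S (2 * 1) i j y → IsOfHodgeType 2 S (2 * 1) i j (ψ y)) ∧
      Set.MapsTo ψ (transcendentalSubspace S) (transcendentalSubspace S) ∧
      (∀ y ∈ transcendentalSubspace S, ψ (ψ y) = (2 : ℂ) • y) ∧
      (∀ y ∈ transcendentalSubspace S, ∀ w ∈ transcendentalSubspace S,
        cupProduct (rfl : 2 * 1 + 2 * 1 = 2 * 2) (ψ y) (ψ w) =
          (2 : ℂ) • cupProduct (rfl : 2 * 1 + 2 * 1 = 2 * 2) y w) ∧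
      (SectorX[X, φ, Θ] → SectorS[S, ψ]) := by
  classical
  obtain ⟨-, hint, -, ⟨hz20, hz20span⟩, -⟩ := id hM
  obtain ⟨-, hintH, -⟩ := id hMH
  have hS2 : IsSmoothProjective 2 S := IsK3Surface.isSmoothProjective hS
  obtain ⟨hΘrat, hΘtyp, hΘT, hΘsq, hΘmul⟩ := hΘ
  -- the marked rational Hodge isometry `e : H²(H) ⥲ H²(X)` and its inverse
  obtain ⟨f, hfbij, hfrat, hfh, hfq⟩ := exists_markedHodgeIsometry_of_partner hcup hμ hX hM hS hηint hcupS
    h20 hxpos hH hMH hθ hi hg1 hg2 hg5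
  obtain ⟨e, he, herat, heh, hseq⟩ := exists_inverse_markedHodgeIsometry hH hX hMH hM hfbij hfrat hfh hfq
  have herat' : ∀ c, IsRationalClass c → IsRationalClass (e c) := fun c hc => by rw [he]; exact hfrat c hc
  have heh' : ∀ (i j : ℕ) c, IsOfHodgeType 4 H 2 i j c → IsOfHodgeType 4 X 2 i j (e c) :=
    fun i j c hc => by rw [he]; exact hfh i j c hc
  have heq : ∀ a b, k3HilbertForm 2 (φ (e a)) (φ (e b)) = k3HilbertForm 2 (φH a) (φH b) :=
    fun a b => by rw [he, he]; exact hfq a b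
  -- `e⁻¹(N¹(X)) ⊆ N¹(H)`
  have hsymmN : ∀ d ∈ algebraicClasses X 1, e.symm d ∈ algebraicClasses H 1 := fun d hd =>
    map_mem_algebraicClasses_of_isRationalClass_of_oneOne hX hH (e.symm : complexBetti X 2 →ₗ[ℂ] complexBetti H 2)
      herat (heh 1 1) hd
  -- `i` and `π`
  set i : complexBetti S (2 * 1) →ₗ[ℂ] complexBetti H 2 :=
    corrAction μ hH hS2 (rfl : 2 * 1 + 2 * 2 = 2 + 2 * 2) θ with hidef
  have hi' : ∀ a, φH (i a) = Sum.elim (η a) 0 := hi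
  set π : complexBetti H 2 →ₗ[ℂ] complexBetti S (2 * 1) :=
    (η.symm : (K3Index → ℂ) →ₗ[ℂ] complexBetti S (2 * 1)) ∘ₗ
      LinearMap.funLeft ℂ ℂ (Sum.inl : K3Index → K3HilbertIndex) ∘ₗ
      (φH : complexBetti H 2 →ₗ[ℂ] (K3HilbertIndex → ℂ)) with hπdef
  have hπ : ∀ w, π w = η.symm (fun k => φH w (Sum.inl k)) := fun w => rfl
  -- `e ∘ i` carries cup-transcendental classes to `q`-transcendental classes, isometrically
  have heiT : ∀ t : complexBetti S (2 * 1),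
      (∀ d ∈ algebraicClasses S 1, cupProduct (rfl : 2 * 1 + 2 * 1 = 2 * 2) t d = 0) →
      ∀ d : complexBetti X 2, d ∈ algebraicClasses X 1 → k3HilbertForm 2 (φ (e (i t))) (φ d) = 0 := by
    intro t htt d hd
    have h1 : k3HilbertForm 2 (φ (e (i t))) (φ d) = k3HilbertForm 2 (φ (e (i t))) (φ (e (e.symm d))) := by
      rw [LinearEquiv.apply_symm_apply]
    rw [h1, heq]
    exact incidence_bbfTransc hS hp0 hηint hcupS h20 hxpos hH hMH hi' htt _ (hsymmN d hd)
  have hform : ∀ a b : complexBetti S (2 * 1),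
      k3Form (η a) (η b) = k3HilbertForm 2 (φ (e (i a))) (φ (e (i b))) := fun a b => by
    rw [heq, hi', hi', k3HilbertForm_inl]
  -- `e⁻¹` carries `q`-transcendental classes of `X` to `q`-transcendental classes of `H`
  have hsymmT : ∀ y : complexBetti X 2, (∀ d ∈ algebraicClasses X 1, k3HilbertForm 2 (φ y) (φ d) = 0) →
      ∀ d ∈ algebraicClasses H 1, k3HilbertForm 2 (φH (e.symm y)) (φH d) = 0 := fun y hy =>
    bbfTransc_map_of_markedHodgeIsometry hX hH e.symm
      (fun c hc => by rw [LinearEquiv.symm_symm]; exact herat' c hc)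
      (fun c hc => by rw [LinearEquiv.symm_symm]; exact heh' 1 1 c hc) hseq hy
  -- `T(S)` membership is cup-orthogonality to `N¹(S)`
  have hTiff : ∀ t : complexBetti S (2 * 1), t ∈ transcendentalSubspace S ↔
      ∀ d ∈ algebraicClasses S 1, cupProduct (rfl : 2 * 1 + 2 * 1 = 2 * 2) t d = 0 :=
    fun t => mem_transcendentalSubspace_iff_forall_algebraicClasses hS2 t
  -- the descended endomorphism `ψ = π ∘ e⁻¹ ∘ Θ ∘ e ∘ i`
  set ψ : complexBetti S (2 * 1) →ₗ[ℂ] complexBetti S (2 * 1) :=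
    π ∘ₗ (e.symm : complexBetti X 2 →ₗ[ℂ] complexBetti H 2) ∘ₗ Θ ∘ₗ
      (e : complexBetti H 2 →ₗ[ℂ] complexBetti X 2) ∘ₗ i with hψdef
  have hψ : ∀ c, ψ c = π (e.symm (Θ (e (i c)))) := fun c => rfl
  have h1 : ∀ c, IsRationalClass c → IsRationalClass (ψ c) := by
    intro c hc
    rw [hψ, hπ]
    exact isRationalClass_retraction hS hH hηint hintH
      (herat _ (hΘrat _ (herat' _ (isRationalClass_incidence hS hH hηint hintH hi' hc))))
  -- Hodge types `(2,0)` and `(1,1)` through the chain, `(0,2)` by conjugation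
  have h20S : ∀ c, IsOfHodgeType 2 S (2 * 1) 2 0 c → IsOfHodgeType 2 S (2 * 1) 2 0 (ψ c) := by
    intro c hc
    rw [hψ, hπ]
    exact retraction_twoZero hMH h20
      (heh 2 0 _ (hΘtyp 2 0 _ (heh' 2 0 _ (incidence_twoZero hMH h20span hi' hc))))
  have h11S : ∀ c, IsOfHodgeType 2 S (2 * 1) 1 1 c → IsOfHodgeType 2 S (2 * 1) 1 1 (ψ c) := by
    intro c hc
    rw [hψ, hπ]
    exact retraction_oneOne hS hp0 hηint hcupS h20 hxpos hMH
      (heh 1 1 _ (hΘtyp 1 1 _ (heh' 1 1 _ (incidence_oneOne hS hp0 hηint hcupS h20 hxpos hMH hi' hc))))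
  have hconj : ∀ c, ψ (conjClass (ComplexPoints S) (2 * 1) c) = conjClass (ComplexPoints S) (2 * 1) (ψ c) :=
    fun c => (conjClass_apply_of_isRationalClass η hηint ψ h1 c).symm
  have h2 : ∀ (a b : ℕ) c, IsOfHodgeType 2 S (2 * 1) a b c → IsOfHodgeType 2 S (2 * 1) a b (ψ c) := by
    intro a b c hc
    by_cases hab : a + b = 2 * 1
    · have ha2 : a ≤ 2 := by omega
      interval_cases a
      · have hb : b = 2 := by omega
        subst hb
        rw [← conjClass_conjClass (ψ c), ← hconj]
        exact (h20S _ (hc.conjClass hS2)).conjClass hS2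
      · have hb : b = 1 := by omega
        subst hb
        exact h11S c hc
      · have hb : b = 0 := by omega
        subst hb
        exact h20S c hc
    · have hc0 : c = 0 := by
        obtain ⟨A, hA⟩ := hc
        rw [(A.hodgePQ_eq_bot_iff (2 * 1) a b).2
            (Literature.NumberTheory.Transcendental.hodgePQ_eq_bot_of_ne (M := A.carrier) hab),
          Submodule.mem_bot] at hA
        exact A.pullback_injective (2 * 1) (by rw [hA, map_zero])
      rw [hc0, map_zero]
      exact isOfHodgeType_zero_of_isSmoothProjective nonempty_hodgeModel_holds hS2 (2 * 1) a b
  -- `Θ (e [θ]_* t) = e [θ]_* (ψ t)` on `T(S)`, and `ψ t ∈ T(S)`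
  have hstep : ∀ t : complexBetti S (2 * 1), (∀ d ∈ algebraicClasses S 1,
      cupProduct (rfl : 2 * 1 + 2 * 1 = 2 * 2) t d = 0) →
      Θ (e (i t)) = e (i (ψ t)) ∧
        ∀ d ∈ algebraicClasses S 1, cupProduct (rfl : 2 * 1 + 2 * 1 = 2 * 2) (ψ t) d = 0 := by
    intro t htt
    have hw : ∀ d ∈ algebraicClasses H 1, k3HilbertForm 2 (φH (e.symm (Θ (e (i t))))) (φH d) = 0 :=
      hsymmT _ (hΘT _ (heiT t htt))
    obtain ⟨hπwT, hiπw⟩ := exists_incidence_eq_of_bbfTransc hcup hμ hS hcupS hH hMH hθ hi hw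
    rw [← hidef, ← hπ] at hiπw
    rw [← hπ] at hπwT
    refine ⟨?_, by rw [hψ]; exact hπwT⟩
    rw [hψ, hiπw, LinearEquiv.apply_symm_apply]
  -- `T(S)`-stability
  have h3 : Set.MapsTo ψ (transcendentalSubspace S) (transcendentalSubspace S) := fun t ht =>
    (hTiff _).2 (hstep t ((hTiff t).1 ht)).2
  -- `ψ² = 2` on `T(S)`
  have h4 : ∀ t ∈ transcendentalSubspace S, ψ (ψ t) = (2 : ℂ) • t := by
    intro t ht
    have htt := (hTiff t).1 ht
    obtain ⟨h1t, h2t⟩ := hstep t htt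
    obtain ⟨h1', -⟩ := hstep _ h2t
    have key : e (i (ψ (ψ t))) = e (i ((2 : ℂ) • t)) := by
      rw [← h1', ← h1t, hΘsq _ (heiT t htt), map_smul, map_smul]
    exact incidence_injective hi' (e.injective key)
  -- multiplier `2` on `T(S)`
  have h5 : ∀ t ∈ transcendentalSubspace S, ∀ s ∈ transcendentalSubspace S,
      cupProduct (rfl : 2 * 1 + 2 * 1 = 2 * 2) (ψ t) (ψ s) =
        (2 : ℂ) • cupProduct (rfl : 2 * 1 + 2 * 1 = 2 * 2) t s := by
    intro t ht s hs
    have htt := (hTiff t).1 ht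
    have hss := (hTiff s).1 hs
    rw [hcupS, hcupS, hform, hform t s, ← (hstep t htt).1, ← (hstep s hss).1,
      hΘmul _ (heiT t htt) _ (heiT s hss), smul_smul]
  -- the sector clause descends
  have h6 : SectorX[X, φ, Θ] → SectorS[S, ψ] := by
    intro hU fS hr hh hk ht
    -- the conjugated endomorphism `fX = e ∘ i ∘ fS ∘ π ∘ e⁻¹`
    set fX : complexBetti X 2 →ₗ[ℂ] complexBetti X 2 :=
      (e : complexBetti H 2 →ₗ[ℂ] complexBetti X 2) ∘ₗ i ∘ₗ fS ∘ₗ π ∘ₗ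
        (e.symm : complexBetti X 2 →ₗ[ℂ] complexBetti H 2) with hfXdef
    have hfX : ∀ c, fX c = e (i (fS (π (e.symm c)))) := fun c => rfl
    have hX1 : ∀ c, IsRationalClass c → IsRationalClass (fX c) := by
      intro c hc
      rw [hfX]
      refine herat' _ (isRationalClass_incidence hS hH hηint hintH hi' (hr _ ?_))
      rw [hπ]
      exact isRationalClass_retraction hS hH hηint hintH (herat c hc)
    have hX3 : ∀ d : complexBetti X 2, d ∈ algebraicClasses X 1 → fX d = 0 := by
      intro d hd
      rw [hfX, hπ, hk _ (retraction_mem_algebraicClasses hS hp0 hηint hcupS h20 hxpos hH hMH (hsymmN d hd)),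
        map_zero, map_zero]
    have hX4 : ∀ y : complexBetti X 2, ∀ d : complexBetti X 2, d ∈ algebraicClasses X 1 →
        k3HilbertForm 2 (φ (fX y)) (φ d) = 0 := by
      intro y d hd
      rw [hfX]
      exact heiT _ (ht _) d hd
    have h20X : ∀ c, IsOfHodgeType 4 X 2 2 0 c → IsOfHodgeType 4 X 2 2 0 (fX c) := by
      intro c hc
      rw [hfX]
      refine heh' 2 0 _ (incidence_twoZero hMH h20span hi' (hh 2 0 _ ?_))
      rw [hπ]
      exact retraction_twoZero hMH h20 (heh 2 0 c hc)
    have h11X : ∀ c, IsOfHodgeType 4 X 2 1 1 c → IsOfHodgeType 4 X 2 1 1 (fX c) := by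
      intro c hc
      rw [hfX]
      refine heh' 1 1 _ (incidence_oneOne hS hp0 hηint hcupS h20 hxpos hMH hi' (hh 1 1 _ ?_))
      rw [hπ]
      exact retraction_oneOne hS hp0 hηint hcupS h20 hxpos hMH (heh 1 1 c hc)
    have hfXconj : ∀ c, fX (conjClass (ComplexPoints X) 2 c) = conjClass (ComplexPoints X) 2 (fX c) :=
      conjClass_map_of_isRationalClass hX hX hint hint fX hX1
    have hX2 : ∀ (a b : ℕ) c, IsOfHodgeType 4 X 2 a b c → IsOfHodgeType 4 X 2 a b (fX c) := by
      intro a b c hc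
      by_cases hab : a + b = 2
      · have ha2 : a ≤ 2 := by omega
        interval_cases a
        · have hb : b = 2 := by omega
          subst hb
          rw [← conjClass_conjClass (fX c), ← hfXconj]
          exact (h20X _ (hc.conjClass hX)).conjClass hX
        · have hb : b = 1 := by omega
          subst hb
          exact h11X c hc
        · have hb : b = 0 := by omega
          subst hb
          exact h20X c hc
      · have hc0 : c = 0 := by
          obtain ⟨A, hA⟩ := hc
          rw [(A.hodgePQ_eq_bot_iff 2 a b).2
              (Literature.NumberTheory.Transcendental.hodgePQ_eq_bot_of_ne (M := A.carrier) hab),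
            Submodule.mem_bot] at hA
          exact A.pullback_injective 2 (by rw [hA, map_zero])
        rw [hc0, map_zero]
        exact isOfHodgeType_zero_of_isSmoothProjective nonempty_hodgeModel_holds hX 2 a b
    -- the sector clause on `X`, read back on `T(S)` through the injective `e ∘ i`
    obtain ⟨a, b, hab⟩ := hU fX hX1 hX2 hX3 hX4
    refine ⟨a, b, fun t htt => ?_⟩
    have hy := hab (e (i t)) (heiT t htt)
    rw [hfX, LinearEquiv.symm_apply_apply, hπ, retraction_incidence hi' t, (hstep t htt).1] at hy
    have hy' : e (i (fS t)) = e (i ((a : ℂ) • t + (b : ℂ) • ψ t)) := by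
      rw [hy, map_add, map_add, map_smul, map_smul, map_smul, map_smul]
    exact incidence_injective hi' (e.injective hy')
  exact ⟨ψ, h1, h2, h3, h4, h5, h6⟩

/-! ### `ρ(X) ≤ ρ(S) + 1` from (g1), (g2), (g5) -/

/-- **`ρ(X) ≤ ρ(S) + 1` along a K3 partner with (g1), (g2), (g5) only** (the marked Hilbert square `H`
explicit): the inverse `e⁻¹` of the marked rational Hodge isometry `e : H²(H) ⥲ H²(X)` embeds `N¹(X)` in
`N¹(H)` (rational `(1,1)`-classes, Lefschetz `(1,1)`), so `ρ(X) ≤ ρ(H)`, and `ρ(H) ≤ ρ(S) + 1`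
(`finrank_algebraicClasses_le_succ_of_hilbertSquareMarking`). [cite: Beauville1983, §6 Prop. 6 and Remarque]
[cite: Huybrechts2016K3, Ch. 3 Lemma 3.1] [cite: VoisinHodgeI2002, Thm. 11.30] -/
theorem finrank_algebraicClasses_le_partner_succ_of_partner
    (hcup : Voisin2003_cupProduct_algebraicClasses) {μ : OrientationFamily} (hμ : μ.HasPoincareDuality)
    (hX : IsSmoothProjective 4 X) (hM : MarkedK3Sq[X, φ, P, z]) (hS : IsK3Surface S) (hp0 : p ≠ 0)
    (hηint : ∀ c : complexBetti S (2 * 1), IsIntegralClass c ↔ ∃ v : K3Index → ℤ, η c = fun i => (v i : ℂ))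
    (hcupS : ∀ a b : complexBetti S (2 * 1),
      cupProduct (rfl : 2 * 1 + 2 * 1 = 2 * 2) a b = k3Form (η a) (η b) • p)
    (h20 : IsOfHodgeType 2 S (2 * 1) 2 0 (η.symm x)) (hxpos : 0 < (k3Form (star x) x).re)
    (hH : IsSmoothProjective 4 H) (hMH : MarkedK3Sq[H, φH, PH, Sum.elim x 0])
    {θ : complexBetti (H ⊗ S) (2 * 2)} (hθ : θ ∈ algebraicClasses (H ⊗ S) 2)
    (hi : ∀ a : complexBetti S (2 * 1),
      φH (corrAction μ hH (IsK3Surface.isSmoothProjective hS) (rfl : 2 * 1 + 2 * 2 = 2 + 2 * 2) θ a) =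
        Sum.elim (η a) 0)
    {g : complexBetti S (2 * 1) →ₗ[ℂ] complexBetti X 2}
    (hg1 : ∀ a, IsRationalClass a → IsRationalClass (g a))
    (hg2 : ∀ (i j : ℕ) a, IsOfHodgeType 2 S (2 * 1) i j a → IsOfHodgeType 4 X 2 i j (g a))
    (hg5 : ∀ a b, (∀ d ∈ algebraicClasses S 1, cupProduct (rfl : 2 * 1 + 2 * 1 = 2 * 2) a d = 0) →
      (∀ d ∈ algebraicClasses S 1, cupProduct (rfl : 2 * 1 + 2 * 1 = 2 * 2) b d = 0) →
      k3HilbertForm 2 (φ (g a)) (φ (g b)) = k3Form (η a) (η b)) :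
    Module.finrank ℂ ↥(algebraicClasses X 1) ≤ Module.finrank ℂ ↥(algebraicClasses S 1) + 1 := by
  classical
  haveI : FiniteDimensional ℂ (complexBetti H 2) := LinearEquiv.finiteDimensional φH.symm
  obtain ⟨f, hfbij, hfrat, hfh, hfq⟩ := exists_markedHodgeIsometry_of_partner hcup hμ hX hM hS hηint hcupS
    h20 hxpos hH hMH hθ hi hg1 hg2 hg5
  obtain ⟨e, -, herat, heh, -⟩ := exists_inverse_markedHodgeIsometry hH hX hMH hM hfbij hfrat hfh hfq
  have hsymmN : ∀ d ∈ algebraicClasses X 1, e.symm d ∈ algebraicClasses H 1 := fun d hd =>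
    map_mem_algebraicClasses_of_isRationalClass_of_oneOne hX hH (e.symm : complexBetti X 2 →ₗ[ℂ] complexBetti H 2)
      herat (heh 1 1) hd
  -- the restriction `N¹(X) → N¹(H)` of `e⁻¹` is injective
  set r : ↥(algebraicClasses X 1) →ₗ[ℂ] ↥(algebraicClasses H 1) :=
    LinearMap.codRestrict (algebraicClasses H 1)
      ((e.symm : complexBetti X 2 →ₗ[ℂ] complexBetti H 2) ∘ₗ (algebraicClasses X 1).subtype)
      (fun d => hsymmN d d.2) with hrdef
  have hr : ∀ d : ↥(algebraicClasses X 1), (r d : complexBetti H 2) = e.symm d := fun d => rfl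
  have hrinj : Function.Injective r := by
    intro a b hab
    apply Subtype.ext
    apply e.symm.injective
    rw [← hr, ← hr, hab]
  exact (LinearMap.finrank_le_finrank_of_injective hrinj).trans
    (finrank_algebraicClasses_le_succ_of_hilbertSquareMarking hS hp0 hηint hcupS h20 hxpos hH hMH)

end Summit.HodgeConjecture.HodgeConjecture.Theorems.MarkmanPartnerTransport.PartnerLattice

end
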